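import Literature.AlgebraicGeometry.Resolution.Hironaka1970NearPointNormalCone
import HarnessLib

/-!
# Hironaka 1970, THEOREM IV: the point-centre statement is the case `D = {x}` of the general one
# (`Hironaka1970_thmIV → Hironaka1970_thmIV_point`, PROVED)

Topic: `Literature/AlgebraicGeometry/Resolution`. The two typed forms of [H4] THEOREM IV p. 156 L11–12 (in the
p. 170 L3–9 reading) — `Hironaka1970_thmIV_point` (`Hironaka1970NearPointInvariantCone.lean`, blow-up of a closed
point, tangent-cone ideal `tangentConeIdeal g`) and `Hironaka1970_thmIV` (`Hironaka1970NearPointNormalCone.lean`,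
blow-up of an arbitrary permissible centre `D`, normal-cone-fibre ideal `normalConeIdeal g`) — are related as the
source relates them («if `D = x`, then we call `C_{X,x}` (`= C_{X,x,x}`) the tangential cone of `X` at `x`», §2
p. 153 L2–3): for `D = {x}` the stalk ideal is `𝔪_x` (`stalkIdeal_vanishingIdeal_singleton`) and the ideal of
`C_{X,{x},x}` is the tangent-cone ideal (`normalConeIdeal_eq_tangentConeIdeal`). Hence the general named fact
IMPLIES the point-centre one (`Hironaka1970_thmIV_point_of_thmIV`), so that consumers of the latter (the OURS
theorem 2.14♯ `directrix_nearPoint_of_geomDirDim_le` of cell res-hironaka) rest on the single fact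
`Hironaka1970_thmIV`. Fact-free reduction; nothing of either fact is proved here. AI-written; AI review is weaker
than expert review.

## References

* H. Hironaka, J. Math. Kyoto Univ. 10 (1970), §2 p. 153 L2–3, THEOREM IV p. 156 L11–12, p. 170 L3–9.
  [Hironaka1970NumericalCharacters]
-/

noncomputable section

open CategoryTheory AlgebraicGeometry TopologicalSpace IsLocalRing
open Literature.RingTheory.HilbertSamuel

namespace Literature.AlgebraicGeometry.Resolution

universe u

/-- **[H4] THEOREM IV for a point centre follows from THEOREM IV for a permissible centre** (`D = {x}`:
`I_{D,x} = 𝔪_x`, `C_{X,D,x} = C_{X,x}`, «if `D = x`, then we call `C_{X,x}` (`= C_{X,x,x}`) the tangential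
cone»). [cite: Hironaka1970NumericalCharacters, §2 p. 153 L2–3; THEOREM IV p. 156 L11–12] -/
theorem Hironaka1970_thmIV_point_of_thmIV (h : Hironaka1970_thmIV.{u}) : Hironaka1970_thmIV_point.{u} := by
  intro X X' _ π x hx N x' hexc hperm hπ hdim hxx' hnear e g hg t u he ht hmap hu
  subst hxx'
  set D : X.IdealSheafData := Scheme.IdealSheafData.vanishingIdeal ⟨{π.base x'}, hx⟩ with hD
  have hxD : π.base x' ∈ (D.support : Set X) := by
    rw [hD, Scheme.IdealSheafData.coe_support_vanishingIdeal]
    exact Set.mem_singleton _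
  have hstalk : stalkIdeal D (π.base x') = maximalIdeal (X.presheaf.stalk (π.base x')) :=
    stalkIdeal_vanishingIdeal_singleton hx
  have hgD : Ideal.span (Set.range g) = stalkIdeal D (π.base x') := hg.trans hstalk.symm
  have heD : (stalkIdeal D (π.base x')).spanFinrank = e := by rw [hstalk]; exact he
  have hmapD : (stalkIdeal D (π.base x')).map (π.stalkMap x').hom = Ideal.span {t} := by rw [hstalk]; exact hmap
  have h' := h X X' π D N x' (π.base x') hexc hperm hπ hdim rfl hxD hnear e g t u hgD heD ht hmapD hu
  rwa [normalConeIdeal_eq_tangentConeIdeal g hg] at h'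

end Literature.AlgebraicGeometry.Resolution

end
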